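import Summits.ValiantsHypothesis.ValiantsHypothesis.Theorems.FeketeSOSFeketeSOSHardPaleyRIPSymNuclear
import Summits.ValiantsHypothesis.ValiantsHypothesis.Theorems.FeketeSOSFeketeSOSHardPaleyRIPSpread

/-!
# Route FeketeSOS — crux `FeketeSOSHard` (stmt-ValiantsHypothesis-3996), line `paley-rip` v3,
# `stub_tameOperator` by ℓ²-SPREADING WITH MULTIPLICITIES (certificate P3′) — every rank, every support,
# IN KERNEL WITHOUT TAKAGI: mass `≤ √#S · (Σ_ν |F_ν|² / r_S(ν))^{1/2} ≤ √(#S · ν_p(S)) · M`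

Certificate P3′ of the census (`Cruxes/FeketeSOSHard/Lines/paley-rip-stub3-census.md` §8; there "rigorous, needs
Takagi for complex patterns") in kernel form, for ALL complex cyclic patterns.  Let `(c_i, w_i)_{i<r}` be weighted
squares supported in `S` with cyclic pattern `F` (`deg F < p`, `X^p − 1 ∣ Σ c_i w_i² − F`).  Write
`r_S(ν) = #{(s,t) ∈ S × S : s + t ≡ ν (mod p)}` (cyclic representation function) and
`ν_p(S) = Σ_{ν ∈ S+S mod p} 1 / r_S(ν)`.  The MULTIPLICITY-SPREAD PREIMAGE

  `τ″_{st} := F_{(s+t) mod p} / r_S((s+t) mod p)`   (`s, t ∈ S`)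

is a complex symmetric matrix on `S × S` whose cyclic anti-diagonal sums are the `F_ν` (the pattern vanishes off
`S + S`, `coeff_pattern_eq_zero`), with `‖τ″‖_F² = Σ_ν |F_ν|² / r_S(ν)`.  A symmetric matrix `T` on an `n`-set is
carried by weighted squares at cost `≤ √n · ‖T‖_F` WITHOUT Takagi's factorisation (`sym_nuclear_le_sqrt_card`):
`T = Σ_σ ½ (t_σ e_σᵀ + e_σ t_σᵀ)` (`t_σ` = the `σ`-th column, `e_σ` the unit vector), each summand is the balanced
polarisation `(1/4s)[(t + s e)(t + s e)ᵀ − (t − s e)(t − s e)ᵀ]`, `s = ‖t‖`, of cost exactly `‖t_σ‖`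
(`polar_entry`, `polar_mass` of `…PaleyRIPSymOuterNuclear.lean`), and `Σ_σ ‖t_σ‖ ≤ √n ‖T‖_F`.  Hence

* `tameOperator_spread_l2` — squares supported in `S`, the same cyclic pattern, mass
  `≤ √#S · (Σ_{ν ∈ S+S} |F_ν|² / r_S(ν))^{1/2}`;
* `tameOperator_spread_l2_sup` — `≤ √(#S · ν_p(S)) · M` when `|F_ν| ≤ M`;
* `tameOperator_spread_sqrt` — `≤ √(#S · #(S+S mod p)) · M` (since `ν_p(S) ≤ #(S+S)`): improves the ℓ¹-spreading
  bound `#(S+S mod p) · M` of `…PaleyRIPSpread.lean` on every support (`#S ≤ #(S+S)`), e.g. exponent `3/2` for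
  every `S` and every rank from `#(S+S) ≤ #S²`;
* `tameOperator_of_nearUniformFibres` — EXPONENT 1 AT EVERY RANK on every support whose cyclic representation
  function is near-uniform in the harmonic sense `ν_p(S) ≤ K² · #S`: mass `≤ K · #S · M`.  (Intervals and
  progressions have `ν = O(log #S)`: exponent `1/2`; random-like `S ⊂ [0, #S^{1+c}]` have `ν ≈ #S^{2c}`:
  exponent `≤ 1` for `c ≤ 1/2` — the "cluster-free, `diam ≤ m^{3/2}`" row of the census §10 coverage map.)

Tools (`sym_nuclear_le_sqrt_card`, `symMatrix_rep`, `sum_sq_eq_gram_sum`, `sum_sum_eq_sum_fibres`) are in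
`…PaleyRIPSymNuclear.lean`; here: fibre bookkeeping (`card_fibre_pos`, `sum_spread_fold`, `sum_norm_sq_spread`),
`eq_sum_sumset_of_pattern` (`F = Σ_{ν∈S+S} F_ν X^ν`), and the theorems.

Honest framing (rung currency): a Theorems-side helper `--supports` stmt-3996; nothing here closes a registered
stub; `stub_tameOperator` (exponent `1+ε` on ALL supports), the engine `stub_paleyFlatRIP` and the crux stay OPEN;
`VP ≠ VNP` is untouched.
-/

set_option linter.dupNamespace false

namespace Summit.ValiantsHypothesis.ValiantsHypothesis.Theorems.FeketeSOSHardPaleyRIP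

open Polynomial Finset
open scoped BigOperators

noncomputable section

/-! ## C. The multiplicity-spread preimage: bookkeeping on the cyclic fibres -/

/-- A residue in the cyclic sumset `S + S (mod p)` has a nonempty fibre. [folklore] -/
theorem card_fibre_pos (S : Finset ℕ) (p : ℕ) {ν : ℕ}
    (hν : ν ∈ (S ×ˢ S).image (fun st : ℕ × ℕ => (st.1 + st.2) % p)) :
    0 < ((S ×ˢ S).filter (fun st : ℕ × ℕ => (st.1 + st.2) % p = ν)).card := by
  classical
  obtain ⟨st, hst, hstν⟩ := Finset.mem_image.1 hν
  exact Finset.card_pos.2 ⟨st, Finset.mem_filter.2 ⟨hst, hstν⟩⟩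

/-- Folding the spread preimage: `Σ_{a,b∈S} (Φ_{a+b} / r_S(a+b)) X^{(a+b) mod p} = Σ_{ν ∈ S+S} Φ_ν X^ν`
(residues mod `p` throughout). [folklore] -/
theorem sum_spread_fold (S : Finset ℕ) (p : ℕ) (Φ : ℕ → ℂ) :
    (∑ a ∈ S, ∑ b ∈ S, C (Φ ((a + b) % p) /
        (((S ×ˢ S).filter (fun st : ℕ × ℕ => (st.1 + st.2) % p = (a + b) % p)).card : ℂ)) *
        X ^ ((a + b) % p)) =
      ∑ ν ∈ (S ×ˢ S).image (fun st : ℕ × ℕ => (st.1 + st.2) % p), C (Φ ν) * X ^ ν := by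
  classical
  rw [sum_sum_eq_sum_fibres S p (fun ab : ℕ × ℕ => C (Φ ((ab.1 + ab.2) % p) /
        (((S ×ˢ S).filter (fun st : ℕ × ℕ => (st.1 + st.2) % p = (ab.1 + ab.2) % p)).card : ℂ)) *
        X ^ ((ab.1 + ab.2) % p))]
  refine Finset.sum_congr rfl fun ν hν => ?_
  have hk : ((((S ×ˢ S).filter (fun st : ℕ × ℕ => (st.1 + st.2) % p = ν)).card : ℕ) : ℂ) ≠ 0 := by
    exact_mod_cast (card_fibre_pos S p hν).ne'
  have hinner : ∀ ab ∈ (S ×ˢ S).filter (fun st : ℕ × ℕ => (st.1 + st.2) % p = ν),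
      C (Φ ((ab.1 + ab.2) % p) /
        (((S ×ˢ S).filter (fun st : ℕ × ℕ => (st.1 + st.2) % p = (ab.1 + ab.2) % p)).card : ℂ)) *
        X ^ ((ab.1 + ab.2) % p) =
      C (Φ ν / (((S ×ˢ S).filter (fun st : ℕ × ℕ => (st.1 + st.2) % p = ν)).card : ℂ)) * X ^ ν := by
    intro ab hab
    rw [(Finset.mem_filter.1 hab).2]
  rw [Finset.sum_congr rfl hinner, Finset.sum_const, nsmul_eq_mul, ← mul_assoc, ← C_eq_natCast, ← map_mul,
    mul_div_cancel₀ _ hk]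

/-- Frobenius norm of the spread preimage: `Σ_{a,b∈S} |Φ_{a+b} / r_S(a+b)|² = Σ_{ν ∈ S+S} |Φ_ν|² / r_S(ν)`
(residues mod `p` throughout). [folklore] -/
theorem sum_norm_sq_spread (S : Finset ℕ) (p : ℕ) (Φ : ℕ → ℂ) :
    (∑ a ∈ S, ∑ b ∈ S, ‖Φ ((a + b) % p) /
        (((S ×ˢ S).filter (fun st : ℕ × ℕ => (st.1 + st.2) % p = (a + b) % p)).card : ℂ)‖ ^ 2) =
      ∑ ν ∈ (S ×ˢ S).image (fun st : ℕ × ℕ => (st.1 + st.2) % p),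
        ‖Φ ν‖ ^ 2 / (((S ×ˢ S).filter (fun st : ℕ × ℕ => (st.1 + st.2) % p = ν)).card : ℝ) := by
  classical
  rw [sum_sum_eq_sum_fibres S p (fun ab : ℕ × ℕ => ‖Φ ((ab.1 + ab.2) % p) /
        (((S ×ˢ S).filter (fun st : ℕ × ℕ => (st.1 + st.2) % p = (ab.1 + ab.2) % p)).card : ℂ)‖ ^ 2)]
  refine Finset.sum_congr rfl fun ν hν => ?_
  have hr : (0 : ℝ) < (((S ×ˢ S).filter (fun st : ℕ × ℕ => (st.1 + st.2) % p = ν)).card : ℝ) := by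
    exact_mod_cast card_fibre_pos S p hν
  have hinner : ∀ ab ∈ (S ×ˢ S).filter (fun st : ℕ × ℕ => (st.1 + st.2) % p = ν),
      ‖Φ ((ab.1 + ab.2) % p) /
        (((S ×ˢ S).filter (fun st : ℕ × ℕ => (st.1 + st.2) % p = (ab.1 + ab.2) % p)).card : ℂ)‖ ^ 2 =
      ‖Φ ν‖ ^ 2 / (((S ×ˢ S).filter (fun st : ℕ × ℕ => (st.1 + st.2) % p = ν)).card : ℝ) ^ 2 := by
    intro ab hab
    rw [(Finset.mem_filter.1 hab).2, norm_div, Complex.norm_natCast, div_pow]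
  rw [Finset.sum_congr rfl hinner, Finset.sum_const, nsmul_eq_mul]
  field_simp

section SpreadL2

variable (p : ℕ) [Fact p.Prime]

/-- The cyclic pattern of squares supported in `S` is carried by the cyclic sumset:
`F = Σ_{ν ∈ S+S mod p} F_ν X^ν` (from `coeff_pattern_eq_zero`). [folklore] -/
theorem eq_sum_sumset_of_pattern (S : Finset ℕ) (r : ℕ) (c : Fin r → ℂ) (w : Fin r → ℂ[X])
    (hw : ∀ i, (w i).support ⊆ S) (F : ℂ[X]) (hF : F.natDegree < p)
    (hdvd : (X : ℂ[X]) ^ p - 1 ∣ (∑ i, C (c i) * w i ^ 2) - F) :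
    F = ∑ ν ∈ (S ×ˢ S).image (fun st : ℕ × ℕ => (st.1 + st.2) % p), C (F.coeff ν) * X ^ ν := by
  classical
  have hp : 0 < p := (Fact.out : p.Prime).pos
  have h1 : F = ∑ n ∈ range p, C (F.coeff n) * X ^ n := by
    conv_lhs => rw [as_sum_range' F p hF]
    simp_rw [C_mul_X_pow_eq_monomial]
  have hvanish : ∀ n ∈ range p, n ∉ (S ×ˢ S).image (fun st : ℕ × ℕ => (st.1 + st.2) % p) →
      C (F.coeff n) * X ^ n = 0 := by
    intro n hn hnT
    have hn' : n < p := mem_range.1 hn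
    have hnot : ((n : ℕ) : ZMod p) ∉ (S ×ˢ S).image (fun st : ℕ × ℕ => ((st.1 + st.2 : ℕ) : ZMod p)) := by
      intro hmem
      obtain ⟨st, hst, hcast⟩ := Finset.mem_image.1 hmem
      have h2 : (st.1 + st.2) % p = n % p := (ZMod.natCast_eq_natCast_iff' (st.1 + st.2) n p).1 hcast
      rw [Nat.mod_eq_of_lt hn'] at h2
      exact hnT (Finset.mem_image.2 ⟨st, hst, h2⟩)
    have hz := coeff_pattern_eq_zero p S r c w hw F hF hdvd (n : ZMod p) hnot
    rw [ZMod.val_natCast, Nat.mod_eq_of_lt hn'] at hz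
    rw [hz, map_zero, zero_mul]
  have hsub : (S ×ˢ S).image (fun st : ℕ × ℕ => (st.1 + st.2) % p) ⊆ range p := by
    intro ν hν
    obtain ⟨st, -, hst⟩ := Finset.mem_image.1 hν
    rw [← hst]
    exact mem_range.2 (Nat.mod_lt _ hp)
  rw [Finset.sum_subset hsub hvanish]
  exact h1

/-! ## D. `stub_tameOperator` by ℓ²-spreading with multiplicities (P3′) -/

/-- **`stub_tameOperator` by ℓ²-spreading with multiplicities — every rank, every support, no Takagi.**
Let weighted squares `(c_i, w_i)_{i<r}` supported in `S` have cyclic pattern `F` (`deg F < p`,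
`X^p − 1 ∣ Σ c_i w_i² − F`).  Then there are weighted squares supported in `S` with the same cyclic pattern and
total mass `≤ √#S · (Σ_{ν ∈ S+S mod p} |F_ν|² / r_S(ν))^{1/2}`, where
`r_S(ν) = #{(s,t) ∈ S × S : (s+t) mod p = ν}`: the preimage `τ″_{st} = F_{(s+t) mod p} / r_S((s+t) mod p)` has
Frobenius norm² `Σ_ν |F_ν|²/r_S(ν)` and is carried by squares at cost `√#S ·` Frobenius (`symMatrix_rep`).
(Census P3′, `paley-rip-stub3-census.md` §8, there "modulo Takagi".) [folklore] -/
theorem tameOperator_spread_l2 (S : Finset ℕ) (r : ℕ) (c : Fin r → ℂ) (w : Fin r → ℂ[X])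
    (hw : ∀ i, (w i).support ⊆ S) (F : ℂ[X]) (hF : F.natDegree < p)
    (hdvd : (X : ℂ[X]) ^ p - 1 ∣ (∑ i, C (c i) * w i ^ 2) - F) :
    ∃ (s' : ℕ) (c' : Fin s' → ℂ) (w' : Fin s' → ℂ[X]), (∀ j, (w' j).support ⊆ S) ∧
      ((X : ℂ[X]) ^ p - 1 ∣ (∑ j, C (c' j) * w' j ^ 2) - F) ∧
      (∑ j, sqMass (c' j) (w' j)) ≤ Real.sqrt S.card *
        Real.sqrt (∑ ν ∈ (S ×ˢ S).image (fun st : ℕ × ℕ => (st.1 + st.2) % p),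
          ‖F.coeff ν‖ ^ 2 / (((S ×ˢ S).filter (fun st : ℕ × ℕ => (st.1 + st.2) % p = ν)).card : ℝ)) := by
  classical
  -- the multiplicity-spread preimage, as an opaque function with its defining equation
  obtain ⟨T, hT⟩ : ∃ T : ℕ → ℕ → ℂ, ∀ a b, T a b = F.coeff ((a + b) % p) /
      (((S ×ˢ S).filter (fun st : ℕ × ℕ => (st.1 + st.2) % p = (a + b) % p)).card : ℂ) :=
    ⟨_, fun a b => rfl⟩
  have hTsymm : ∀ a b, T a b = T b a := fun a b => by rw [hT, hT, add_comm]
  obtain ⟨s', c', g, hg, hgram, hmass⟩ := symMatrix_rep S T hTsymm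
  refine ⟨s', c', g, hg, ?_, hmass.trans (le_of_eq ?_)⟩
  · -- same cyclic pattern
    have hP : (∑ j, C (c' j) * g j ^ 2) = ∑ a ∈ S, ∑ b ∈ S, C (T a b) * X ^ (a + b) := by
      rw [sum_sq_eq_gram_sum S c' g hg]
      refine Finset.sum_congr rfl fun a ha => Finset.sum_congr rfl fun b hb => ?_
      rw [hgram, if_pos ⟨ha, hb⟩]
    -- fold the exponents mod `p`
    have hfold : (X : ℂ[X]) ^ p - 1 ∣ (∑ a ∈ S, ∑ b ∈ S, C (T a b) * X ^ (a + b)) -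
        ∑ a ∈ S, ∑ b ∈ S, C (T a b) * X ^ ((a + b) % p) := by
      rw [← Finset.sum_sub_distrib]
      refine Finset.dvd_sum fun a _ => ?_
      rw [← Finset.sum_sub_distrib]
      refine Finset.dvd_sum fun b _ => ?_
      have h := (FeketeSOSHardSketch.grt_X_pow_sub_one_dvd_X_pow_mod_sub p (a + b)).mul_left (C (T a b))
      rw [mul_sub] at h
      rw [← dvd_neg, neg_sub]
      exact h
    -- the folded sum is `Σ_{ν ∈ S+S} F_ν X^ν = F`
    have hQ : (∑ a ∈ S, ∑ b ∈ S, C (T a b) * X ^ ((a + b) % p)) =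
        ∑ ν ∈ (S ×ˢ S).image (fun st : ℕ × ℕ => (st.1 + st.2) % p), C (F.coeff ν) * X ^ ν := by
      rw [← sum_spread_fold S p (fun n => F.coeff n)]
      exact Finset.sum_congr rfl fun a _ => Finset.sum_congr rfl fun b _ => by rw [hT]
    have hQF : (X : ℂ[X]) ^ p - 1 ∣ (∑ a ∈ S, ∑ b ∈ S, C (T a b) * X ^ ((a + b) % p)) - F := by
      rw [hQ, ← eq_sum_sumset_of_pattern p S r c w hw F hF hdvd, sub_self]
      exact dvd_zero _
    rw [hP]
    have := dvd_add hfold hQF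
    rwa [sub_add_sub_cancel] at this
  · -- Frobenius norm of the preimage
    congr 2
    rw [← sum_norm_sq_spread S p (fun n => F.coeff n)]
    exact Finset.sum_congr rfl fun a _ => Finset.sum_congr rfl fun b _ => by rw [hT]

/-- **P3′ with the sup norm: mass `≤ √(#S · ν_p(S)) · M`**, `ν_p(S) = Σ_{ν ∈ S+S mod p} 1/r_S(ν)`, when every
cyclic pattern coefficient has modulus `≤ M`. [folklore] -/
theorem tameOperator_spread_l2_sup (S : Finset ℕ) (r : ℕ) (c : Fin r → ℂ) (w : Fin r → ℂ[X])
    (hw : ∀ i, (w i).support ⊆ S) (F : ℂ[X]) (M : ℝ) (hF : F.natDegree < p)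
    (hdvd : (X : ℂ[X]) ^ p - 1 ∣ (∑ i, C (c i) * w i ^ 2) - F) (hM : ∀ n, ‖F.coeff n‖ ≤ M) :
    ∃ (s' : ℕ) (c' : Fin s' → ℂ) (w' : Fin s' → ℂ[X]), (∀ j, (w' j).support ⊆ S) ∧
      ((X : ℂ[X]) ^ p - 1 ∣ (∑ j, C (c' j) * w' j ^ 2) - F) ∧
      (∑ j, sqMass (c' j) (w' j)) ≤ Real.sqrt ((S.card : ℝ) *
        ∑ ν ∈ (S ×ˢ S).image (fun st : ℕ × ℕ => (st.1 + st.2) % p),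
          (1 : ℝ) / (((S ×ˢ S).filter (fun st : ℕ × ℕ => (st.1 + st.2) % p = ν)).card : ℝ)) * M := by
  classical
  have hM0 : 0 ≤ M := (norm_nonneg _).trans (hM 0)
  obtain ⟨s', c', w', h1, h2, h3⟩ := tameOperator_spread_l2 p S r c w hw F hF hdvd
  refine ⟨s', c', w', h1, h2, h3.trans ?_⟩
  rw [Real.sqrt_mul (Nat.cast_nonneg _), mul_assoc]
  refine mul_le_mul_of_nonneg_left ?_ (Real.sqrt_nonneg _)
  have hsum_nonneg : 0 ≤ ∑ ν ∈ (S ×ˢ S).image (fun st : ℕ × ℕ => (st.1 + st.2) % p),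
      (1 : ℝ) / (((S ×ˢ S).filter (fun st : ℕ × ℕ => (st.1 + st.2) % p = ν)).card : ℝ) :=
    Finset.sum_nonneg fun ν _ => by positivity
  calc Real.sqrt (∑ ν ∈ (S ×ˢ S).image (fun st : ℕ × ℕ => (st.1 + st.2) % p),
          ‖F.coeff ν‖ ^ 2 / (((S ×ˢ S).filter (fun st : ℕ × ℕ => (st.1 + st.2) % p = ν)).card : ℝ))
      ≤ Real.sqrt ((∑ ν ∈ (S ×ˢ S).image (fun st : ℕ × ℕ => (st.1 + st.2) % p),
          (1 : ℝ) / (((S ×ˢ S).filter (fun st : ℕ × ℕ => (st.1 + st.2) % p = ν)).card : ℝ)) * M ^ 2) := by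
        refine Real.sqrt_le_sqrt ?_
        rw [Finset.sum_mul]
        refine Finset.sum_le_sum fun ν _ => ?_
        rw [div_mul_eq_mul_div, one_mul]
        exact div_le_div_of_nonneg_right (pow_le_pow_left₀ (norm_nonneg _) (hM ν) 2) (Nat.cast_nonneg _)
    _ = Real.sqrt (∑ ν ∈ (S ×ˢ S).image (fun st : ℕ × ℕ => (st.1 + st.2) % p),
          (1 : ℝ) / (((S ×ˢ S).filter (fun st : ℕ × ℕ => (st.1 + st.2) % p = ν)).card : ℝ)) * M := by
        rw [Real.sqrt_mul hsum_nonneg, Real.sqrt_sq hM0]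

/-- **P3′, counting form: mass `≤ √(#S · #(S+S mod p)) · M`** (every rank, every support) — improves the
ℓ¹-spreading bound `#(S+S mod p) · M` of `tameOperator_spread` since `#S ≤ #(S+S)`; e.g. exponent `3/2` for
every support from `#(S+S) ≤ #S²`. [folklore] -/
theorem tameOperator_spread_sqrt (S : Finset ℕ) (r : ℕ) (c : Fin r → ℂ) (w : Fin r → ℂ[X])
    (hw : ∀ i, (w i).support ⊆ S) (F : ℂ[X]) (M : ℝ) (hF : F.natDegree < p)
    (hdvd : (X : ℂ[X]) ^ p - 1 ∣ (∑ i, C (c i) * w i ^ 2) - F) (hM : ∀ n, ‖F.coeff n‖ ≤ M) :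
    ∃ (s' : ℕ) (c' : Fin s' → ℂ) (w' : Fin s' → ℂ[X]), (∀ j, (w' j).support ⊆ S) ∧
      ((X : ℂ[X]) ^ p - 1 ∣ (∑ j, C (c' j) * w' j ^ 2) - F) ∧
      (∑ j, sqMass (c' j) (w' j)) ≤ Real.sqrt ((S.card : ℝ) *
        (((S ×ˢ S).image (fun st : ℕ × ℕ => (st.1 + st.2) % p)).card : ℝ)) * M := by
  classical
  have hM0 : 0 ≤ M := (norm_nonneg _).trans (hM 0)
  obtain ⟨s', c', w', h1, h2, h3⟩ := tameOperator_spread_l2_sup p S r c w hw F M hF hdvd hM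
  refine ⟨s', c', w', h1, h2, h3.trans (mul_le_mul_of_nonneg_right (Real.sqrt_le_sqrt
    (mul_le_mul_of_nonneg_left ?_ (Nat.cast_nonneg _))) hM0)⟩
  have h : ∀ ν ∈ (S ×ˢ S).image (fun st : ℕ × ℕ => (st.1 + st.2) % p),
      (1 : ℝ) / (((S ×ˢ S).filter (fun st : ℕ × ℕ => (st.1 + st.2) % p = ν)).card : ℝ) ≤ 1 := by
    intro ν hν
    obtain ⟨st, hst, hstν⟩ := Finset.mem_image.1 hν
    have hpos : (0 : ℝ) < (((S ×ˢ S).filter (fun st : ℕ × ℕ => (st.1 + st.2) % p = ν)).card : ℝ) := by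
      exact_mod_cast Finset.card_pos.2 ⟨st, Finset.mem_filter.2 ⟨hst, hstν⟩⟩
    rw [div_le_one hpos]
    exact_mod_cast Finset.card_pos.2 ⟨st, Finset.mem_filter.2 ⟨hst, hstν⟩⟩
  calc (∑ ν ∈ (S ×ˢ S).image (fun st : ℕ × ℕ => (st.1 + st.2) % p),
        (1 : ℝ) / (((S ×ˢ S).filter (fun st : ℕ × ℕ => (st.1 + st.2) % p = ν)).card : ℝ))
      ≤ ∑ ν ∈ (S ×ˢ S).image (fun st : ℕ × ℕ => (st.1 + st.2) % p), (1 : ℝ) := Finset.sum_le_sum h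
    _ = (((S ×ˢ S).image (fun st : ℕ × ℕ => (st.1 + st.2) % p)).card : ℝ) := by
        rw [Finset.sum_const, nsmul_eq_mul, mul_one]

/-- **Exponent 1 at every rank on supports with harmonically near-uniform representation function.**  If
`ν_p(S) = Σ_{ν ∈ S+S mod p} 1/r_S(ν) ≤ K² · #S`, then every family of weighted squares supported in `S` is
replaced by one with the same cyclic pattern and mass `≤ K · #S · M`. [folklore] -/
theorem tameOperator_of_nearUniformFibres (S : Finset ℕ) (K : ℝ) (hK : 0 ≤ K)
    (hν : (∑ ν ∈ (S ×ˢ S).image (fun st : ℕ × ℕ => (st.1 + st.2) % p),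
      (1 : ℝ) / (((S ×ˢ S).filter (fun st : ℕ × ℕ => (st.1 + st.2) % p = ν)).card : ℝ)) ≤
        K ^ 2 * S.card)
    (r : ℕ) (c : Fin r → ℂ) (w : Fin r → ℂ[X])
    (hw : ∀ i, (w i).support ⊆ S) (F : ℂ[X]) (M : ℝ) (hF : F.natDegree < p)
    (hdvd : (X : ℂ[X]) ^ p - 1 ∣ (∑ i, C (c i) * w i ^ 2) - F) (hM : ∀ n, ‖F.coeff n‖ ≤ M) :
    ∃ (s' : ℕ) (c' : Fin s' → ℂ) (w' : Fin s' → ℂ[X]), (∀ j, (w' j).support ⊆ S) ∧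
      ((X : ℂ[X]) ^ p - 1 ∣ (∑ j, C (c' j) * w' j ^ 2) - F) ∧
      (∑ j, sqMass (c' j) (w' j)) ≤ K * S.card * M := by
  classical
  have hM0 : 0 ≤ M := (norm_nonneg _).trans (hM 0)
  obtain ⟨s', c', w', h1, h2, h3⟩ := tameOperator_spread_l2_sup p S r c w hw F M hF hdvd hM
  refine ⟨s', c', w', h1, h2, h3.trans (mul_le_mul_of_nonneg_right ?_ hM0)⟩
  calc Real.sqrt ((S.card : ℝ) * ∑ ν ∈ (S ×ˢ S).image (fun st : ℕ × ℕ => (st.1 + st.2) % p),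
          (1 : ℝ) / (((S ×ˢ S).filter (fun st : ℕ × ℕ => (st.1 + st.2) % p = ν)).card : ℝ))
      ≤ Real.sqrt ((S.card : ℝ) * (K ^ 2 * S.card)) :=
        Real.sqrt_le_sqrt (mul_le_mul_of_nonneg_left hν (Nat.cast_nonneg _))
    _ = K * S.card := by
        rw [show (S.card : ℝ) * (K ^ 2 * S.card) = (K * S.card) ^ 2 by ring]
        exact Real.sqrt_sq (by positivity)

end SpreadL2

end

end Summit.ValiantsHypothesis.ValiantsHypothesis.Theorems.FeketeSOSHardPaleyRIP
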